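import Literature.AnabelianGeometry.EtaleTheta.Discharge.Sec5Prop52iiiRootKummerOfBiKummerData
import Literature.AnabelianGeometry.EtaleTheta.Discharge.Sec5Thm57KummerComparisonOfPin

/-!
# [EtTh] Thm. 5.7 (C)-junction: the Prop. 5.2 (iii) input `hpin` of abc-iut-L2-d4's `kummerComparison_of_pin` FROM the dictionary F-0521
# (Prop. 5.2 (iii) p. 324, Thm. 5.7 proof p. 330 / PDF pp. 98, 104) — PROOF-ONLY glue, generic over any §5 data `𝔉`

Mochizuki, *The étale theta function and its Frobenioid-theoretic manifestations*, Publ. RIMS **45** (2009) [MochizukiEtTh2009], Prop. 5.2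
(iii) p.324 (PDF p.98) («the Kummer class determined by the bi-Kummer `N`-th root … corresponds precisely to the reduction modulo `N` of the
class `η̲̈^Θ` … relative to the natural isomorphism … between "`μ_N(−)`" and `(l·Δ_Θ) ⊗ (ℤ/Nℤ)`»); Thm. 5.7 proof p.330 (PDF p.104) («applying the
rigidity of the étale theta function to the Kummer classes of Proposition 5.2, (iii)»).
[cite: MochizukiEtTh2009, Prop 5.2 (iii) p.324 (PDF p.98); Thm 5.7 p.330 (PDF p.104)]

abc-iut cell, layer L2, seat abc-iut-L2-t4 (gen 5; §5 owner lineage), abc-iut-L2-lead (gen 4) R408 «(C)-JUNCTION»: of the three named inputs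
of abc-iut-L2-d4's `ThetaFrobenioid.kummerComparison_of_pin` (p449260) — (pin) Prop. 5.2 (iii), (K4β) Thm. 5.6, (C5Δ) Cor. 2.8 (i) — this
file PRODUCES `(pin)` VERBATIM, «`∀ h ∈ H_{B_N}`, `s^⊓-gp_N(h)·s^⊔-gp_N(h)⁻¹ = ρ(η̃ h)`», from abc-iut-L2-t11's dictionary F-0521
(`ThetaSectionCompat H T ι m hYdd η`) and ONE law tying the consumer's reading `η̃ : H_{B_N} → M`, `ρ : M → Aut_C(B_N)` to the dictionary's
`m⁻¹ ∘ η ∘ ι` on `Π^tp_Ÿ` (`hη̃`); and `exists_reading_hpin_of_thetaSectionCompat`: under F-0521 such a reading `η̃ : H_{B_N} → M` with its law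
EXISTS for any normalisation `e` with `ρ ∘ e = m⁻¹` (`η ∘ ι` factors through `Π^tp_Ÿ ↠ H_{B_N}`, `eta_iota_eq_of_rhoYdd_eq`).  Pure bookkeeping over my p448761 `sgpCap_mul_sgpCup_inv_eq_of_thetaSectionCompat` (print orientation on
`Π^tp_Ÿ`) and `H_{B_N} = ρ(Π^tp_Ÿ)`; nothing landed is edited or restated; 0 `def`s.
HONEST FRAMING: F-0521 itself (⟺ the junction «`θ := Θ̈`», G-L2t4-2, in function currency by p448930) stays a hypothesis; typed ≠ proved; no
side is taken on anything downstream ([IUTchIII] Cor. 3.12).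
-/

noncomputable section

namespace Literature.AnabelianGeometry.EtaleTheta

open CategoryTheory

universe w v v' u u'

namespace ThetaFrobenioid

variable {C : Type u} [Category.{v} C] {D : Type u'} [Category.{v'} D] (𝔉 : ThetaFrobenioid.{w} C D)

/-- Every element of `H_{B_N} = ρ(Π^tp_Ÿ)` is `ρ` of an element of `Π^tp_Ÿ` (`rhoYdd` is onto `H_{B_N}`).
[cite: MochizukiEtTh2009, §5 p.331 (PDF p.105)] -/
theorem rhoYdd_surjective : Function.Surjective 𝔉.rhoYdd := by
  rintro ⟨x, hx⟩
  obtain ⟨k, hk, hkx⟩ := hx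
  exact ⟨⟨k, hk⟩, Subtype.ext hkx⟩

/-- **`(pin)` of `kummerComparison_of_pin` FROM F-0521**: if the bi-Kummer difference read through `m` is `η⁻¹` on `Π^tp_Ÿ` (abc-iut-L2-t11's
`ThetaSectionCompat`) and the consumer's reading `(ρ, η̃)` agrees with `m⁻¹ ∘ η ∘ ι` along `Π^tp_Ÿ ↠ H_{B_N}` (`hη̃`), then for every
`h ∈ H_{B_N}`, `s^⊓-gp_N(h)·s^⊔-gp_N(h)⁻¹ = ρ(η̃ h)` — «the Kummer class determined by the bi-Kummer `N`-th root … corresponds precisely to …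
`η̲̈^Θ` … relative to [the identification]».  [cite: MochizukiEtTh2009, Prop 5.2 (iii) p.324 (PDF p.98); Thm 5.7 p.330 (PDF p.104)] -/
theorem hpin_of_thetaSectionCompat {M : Type*} (ρM : M → Aut 𝔉.BN) (ηM : 𝔉.HB → M) (H : 𝔉.Facts)
    (T : ThetaEnvData.{v} 𝔉.N) (ι : 𝔉.PiX ≃* T.PiX) (m : 𝔉.muTorsion 𝔉.BN 𝔉.N ≃* T.mu) (hYdd : 𝔉.IdentifiesPiYdd T ι)
    {η : T.PiYdd → T.mu} (hc : 𝔉.ThetaSectionCompat H T ι m hYdd η)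
    (hηM : ∀ k : 𝔉.PiYdd, ρM (ηM (𝔉.rhoYdd k)) =
      ((m.symm (η ⟨ι k, (hYdd k).mp k.2⟩) : 𝔉.muTorsion 𝔉.BN 𝔉.N) : Aut 𝔉.BN)) :
    ∀ h : 𝔉.HB, 𝔉.sgpCap (h : Aut (𝔉.base.obj 𝔉.BN)) * (𝔉.sgpCup h)⁻¹ = ρM (ηM h) := by
  intro h
  obtain ⟨k, rfl⟩ := 𝔉.rhoYdd_surjective h
  have hk : 𝔉.rhoYdd k = ⟨𝔉.ρ k, Subgroup.mem_map_of_mem _ k.2⟩ := Subtype.ext rfl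
  rw [hηM k, hk]
  exact 𝔉.sgpCap_mul_sgpCup_inv_eq_of_thetaSectionCompat H T ι m hYdd hc k

/-- **`(pin)` with the reading pinned by a normalisation**: if `η̃ ∘ ρ = e ∘ η ∘ ι` on `Π^tp_Ÿ` for a map `e : μ_N(T) → M` with `ρ ∘ e = m⁻¹`
(abc-iut-w4-d099's normalisation `hme` between abc-iut-L2-t11's `m` and the Prop. 5.5 identification at `B_N`, read pointwise), then `(pin)`
holds.  [cite: MochizukiEtTh2009, Prop 5.2 (iii) p.324 (PDF p.98); Prop 5.5 p.327 (PDF p.101)] -/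
theorem hpin_of_thetaSectionCompat_of_hme {M : Type*} (ρM : M → Aut 𝔉.BN) (ηM : 𝔉.HB → M) (H : 𝔉.Facts)
    (T : ThetaEnvData.{v} 𝔉.N) (ι : 𝔉.PiX ≃* T.PiX) (m : 𝔉.muTorsion 𝔉.BN 𝔉.N ≃* T.mu) (hYdd : 𝔉.IdentifiesPiYdd T ι)
    {η : T.PiYdd → T.mu} (hc : 𝔉.ThetaSectionCompat H T ι m hYdd η) (e : T.mu → M)
    (hme : ∀ x : T.mu, ρM (e x) = ((m.symm x : 𝔉.muTorsion 𝔉.BN 𝔉.N) : Aut 𝔉.BN))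
    (hηM : ∀ k : 𝔉.PiYdd, ηM (𝔉.rhoYdd k) = e (η ⟨ι k, (hYdd k).mp k.2⟩)) :
    ∀ h : 𝔉.HB, 𝔉.sgpCap (h : Aut (𝔉.base.obj 𝔉.BN)) * (𝔉.sgpCup h)⁻¹ = ρM (ηM h) :=
  𝔉.hpin_of_thetaSectionCompat ρM ηM H T ι m hYdd hc fun k => by rw [hηM k, hme]

/-- Under F-0521 the theta cocycle read along `ι` FACTORS THROUGH `Π^tp_Ÿ ↠ H_{B_N}`: `η(ι k)` depends only on `ρ k` (because
`m(d(k)) = η(ι k)⁻¹` and the bi-Kummer difference `d(k)` is a function of `ρ k`).  [cite: MochizukiEtTh2009, Prop 5.2 (iii) p.324 (PDF p.98)] -/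
theorem eta_iota_eq_of_rhoYdd_eq (H : 𝔉.Facts) (T : ThetaEnvData.{v} 𝔉.N) (ι : 𝔉.PiX ≃* T.PiX)
    (m : 𝔉.muTorsion 𝔉.BN 𝔉.N ≃* T.mu) (hYdd : 𝔉.IdentifiesPiYdd T ι) {η : T.PiYdd → T.mu}
    (hc : 𝔉.ThetaSectionCompat H T ι m hYdd η) {k k' : 𝔉.PiYdd} (hkk : 𝔉.rhoYdd k = 𝔉.rhoYdd k') :
    η ⟨ι k, (hYdd k).mp k.2⟩ = η ⟨ι k', (hYdd k').mp k'.2⟩ := by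
  have hd : 𝔉.diffCocycle H k = 𝔉.diffCocycle H k' := by
    apply Subtype.ext
    change 𝔉.sgpCup (𝔉.rhoYdd k) * (𝔉.sgpCap (𝔉.rhoYdd k : Aut (𝔉.base.obj 𝔉.BN)))⁻¹ =
      𝔉.sgpCup (𝔉.rhoYdd k') * (𝔉.sgpCap (𝔉.rhoYdd k' : Aut (𝔉.base.obj 𝔉.BN)))⁻¹
    rw [hkk]
  have e1 := hc k
  have e2 := hc k'
  rw [hd, e2] at e1
  exact inv_injective e1.symm

/-- **A reading `η̃` on `H_{B_N}` with its law, and `(pin)` for it, EXIST under F-0521** (no choice left to the consumer beyond the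
normalisation `e`): `η̃(ρ k) = e(η(ι k))` for all `k ∈ Π^tp_Ÿ` (well defined by `eta_iota_eq_of_rhoYdd_eq`) and
`s^⊓-gp_N(h)·s^⊔-gp_N(h)⁻¹ = ρ(η̃ h)` for all `h ∈ H_{B_N}`.  The R-C5 side proves (C5Δ) for any `η̃` with this law.
[cite: MochizukiEtTh2009, Prop 5.2 (iii) p.324 (PDF p.98); Thm 5.7 p.330 (PDF p.104)] -/
theorem exists_reading_hpin_of_thetaSectionCompat {M : Type*} (ρM : M → Aut 𝔉.BN) (H : 𝔉.Facts)
    (T : ThetaEnvData.{v} 𝔉.N) (ι : 𝔉.PiX ≃* T.PiX) (m : 𝔉.muTorsion 𝔉.BN 𝔉.N ≃* T.mu) (hYdd : 𝔉.IdentifiesPiYdd T ι)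
    {η : T.PiYdd → T.mu} (hc : 𝔉.ThetaSectionCompat H T ι m hYdd η) (e : T.mu → M)
    (hme : ∀ x : T.mu, ρM (e x) = ((m.symm x : 𝔉.muTorsion 𝔉.BN 𝔉.N) : Aut 𝔉.BN)) :
    ∃ ηM : 𝔉.HB → M, (∀ k : 𝔉.PiYdd, ηM (𝔉.rhoYdd k) = e (η ⟨ι k, (hYdd k).mp k.2⟩)) ∧
      ∀ h : 𝔉.HB, 𝔉.sgpCap (h : Aut (𝔉.base.obj 𝔉.BN)) * (𝔉.sgpCup h)⁻¹ = ρM (ηM h) := by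
  classical
  let sec : 𝔉.HB → 𝔉.PiYdd := fun h => Classical.choose (𝔉.rhoYdd_surjective h)
  have hsec : ∀ h, 𝔉.rhoYdd (sec h) = h := fun h => Classical.choose_spec (𝔉.rhoYdd_surjective h)
  refine ⟨fun h => e (η ⟨ι (sec h), (hYdd (sec h)).mp (sec h).2⟩), ?_, ?_⟩
  · intro k
    exact congrArg e (𝔉.eta_iota_eq_of_rhoYdd_eq H T ι m hYdd hc (hsec (𝔉.rhoYdd k)))
  · exact 𝔉.hpin_of_thetaSectionCompat_of_hme ρM _ H T ι m hYdd hc e hme fun k =>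
      congrArg e (𝔉.eta_iota_eq_of_rhoYdd_eq H T ι m hYdd hc (hsec (𝔉.rhoYdd k)))

end ThetaFrobenioid

end Literature.AnabelianGeometry.EtaleTheta

end
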